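import Literature.NumberTheory.EllipticCurves.KatoAdditiveTwistedValueNeronIntegrality
import Literature.NumberTheory.EllipticCurves.SkinnerUrban2014.PAdicUnitPeriodRatioAnyPrimeProofs
import Literature.NumberTheory.EllipticCurves.SkinnerUrban2014.PAdicUnitImaginaryPeriodRatioProofs
import Summits.BirchSwinnertonDyer.BirchSwinnertonDyer.Theorems.EdixhovenFibreFiveSevenTwistDegreeStepFiveSevenTorsTwist
import HarnessLib

/-!
# F″ programme, piece P6: PRIME-TO-`p` ISOGENY TRANSPORT of Kato's Néron-unit integrality
# (`kato_neron_isIntegral_twistedSymbolSum_of_additive_five_le`) between globally minimal models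
# (route `EdixhovenFibreFiveSeven`, crux K★ `StarredOptimalManinUnitFiveSeven`, stmt-BirchSwinnertonDyer-22226,
# line `kato-lever`; `--supports` 22226, helper)

Cell `pub/bsd-wall`, seat `bsd-line-edix-p4` g2 (WIDTH-5 attach). TOOL theorems only (no definition, no named
fact, no `sorry`); nothing is closed or booked; BSD is not proved by any of this.

WHY. The registered skeleton `Cruxes/StarredOptimalManinUnitFiveSeven/Lines/kato_lever.lean` (v2) has ONE stub:
F″ = `Literature.NumberTheory.EllipticCurves.kato_neron_isIntegral_twistedSymbolSum_of_additive_five_le`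
(cite-only, XL; K★ ⟸ F″ is the tree theorem `…Theorems.starredOptimalManinUnitFiveSeven_of_kato`, p581141).
The programme that would discharge F″ (`Lines/kato-lever-F2-programme.md`, seat edix-p1 g4, §4) reads Kato's
zeta elements at the member `E•` of the isogeny class whose Tate module is Kato's lattice `V_{ℤ_p}(f)(1)`
(P1, typer), runs the Kim–Nakamura / Kosters–Pannekoek receptacle there (P2–P4), and then needs
**P6: transport of F″'s displayed conclusion from that ONE globally minimal member to every prime-to-`p`
isogenous globally minimal `V`** ("Néron periods change by `p`-units; `a_ℓ`, `f`, Addv, Irr, local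
`p`-torsion transport" — item 1 of F″'s own docstring derivation). This file IS P6, independent of the
final shape of P1: it moves F″'s conclusion, whatever proves it at the member.

WHAT IS PROVED (`V ∼ W` globally minimal elliptic curves over `ℚ`, `p` prime).
* §1 `exists_isIntegral_of_int_mul` — the arithmetic core: if `a·ϖ' = q·ϖ` with `p ∤ q` and
  `s·ϖ'·r ∈ ℤ̄` for some `p ∤ s`, then `s'·ϖ·r ∈ ℤ̄` for some `p ∤ s'` (`s' = s·q²`).
* §1 `transport_of_int_mul_period` — abstract form: an integrality clause
  "`ϖ·Ω_W = P ⟹ R(r) ⟹ ∃ s, p ∤ s, s·ϖ·r ∈ ℤ̄`" passes from `Ω_W` to `Ω_V` whenever `q·Ω_W = a·Ω_V` with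
  `p ∤ q`, `a ≠ 0` (put `ϖ' := ϖ·q/a`).
* §2 `exists_int_mul_realPeriodRat_eq_of_not_dvd_degree`, `exists_int_mul_imaginaryPeriodRat_eq_of_not_dvd_degree`
  — for a `ℚ`-isogeny `ψ : W → V` of degree prime to `p` between GLOBALLY MINIMAL curves with a newform `f`:
  `q·Ω(W) = a·Ω(V)` and `q'·|Ω⁻(W)| = a'·|Ω⁻(V)|` with `p ∤ q, a, q', a'` (Greenberg–Vatsal 2000 Remark 3.4;
  the tree's `ModularParametrizationData.exists_int_mul_realPeriodRat_eq_of_isogeny` /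
  `SkinnerUrban2014.exists_int_mul_imaginaryPeriodRat_eq_of_isogeny`, `q ∣ deg ψ`, `ab = deg ψ`, fed with the
  data `nonempty_modularParametrizationData_of_isNewformOf`).
* §3 `hyps_of_isIsogenous` — the HYPOTHESES of F″ move along the class: `IsNewformOf`, not good / not
  multiplicative at `p`, `E[p]` irreducible, and the Kosters–Pannekoek clause
  `7 < p ∨ (gcd(ord_m p, p − 1) = 1 ∧ E(ℚ_p)[p] = 0)` (`TorsTwist.exists_prime_smul_eq_zero_of_isIsogenous`).
* §3 **`body_of_isIsogenous`** — the CONCLUSION of F″ (both parities, verbatim: `∃ s, p ∤ s, s·ϖ·r ∈ ℤ̄`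
  whenever `ϖ·Ω^±(·) = Ω^±_f` and `∏_{ℓ ∥ N}(ℓ − a_ℓχ(ℓ))(ℓ − a_ℓχ̄(ℓ))·Σ_aχ(a){∞,a/m}_f = r·Ω^±_f(·i)`) at a
  globally minimal `W` implies the same at every globally minimal `V ∼ W` with `V[p]` irreducible
  (`exists_isogeny_not_dvd_degree_of_irreducible`: under irreducibility the class is joined by isogenies of
  degree prime to `p`; `a_ℓ(W) = a_ℓ(V)` by `IsIsogenous.LFunction_eq`).
* §4 **`kato_neron_five_le_of_forall_exists_member`** — the SOCKET for P1–P4: if for every `V` satisfying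
  F″'s hypotheses SOME globally minimal member `W ∼ V` satisfies F″'s conclusion at `(f, p, m, χ)`, then F″;
  and `kato_neron_five_le_of_forall_exists_member'` — the same where the member's conclusion is granted only
  under the member's OWN copy of F″'s hypotheses.

References: [GreenbergVatsal2000] R. Greenberg, V. Vatsal, Invent. Math. 142 (2000), §3 Remark 3.4 (Néron
periods in an isogeny class differ by `p`-units when `E[p]` is irreducible); [SilvermanAEC2009] Thm. VI.4.1(b),
Cor. III.4.11; [Kato2004Asterisque] §8.3 p. 181, (8.1.3) (the lattice `V_{O_λ}(f)` and the member it defines);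
[Wuthrich2014] §3 Prop. 8; [KimNakamura2020] §2. Programme: `Cruxes/StarredOptimalManinUnitFiveSeven/Lines/
kato-lever-F2-programme.md` §1 (transport item), §4 (P6).
-/

set_option autoImplicit false
-- the Theorems namespace of a single-conjunct summit repeats the summit name by design (D-0017)
set_option linter.dupNamespace false

noncomputable section

open scoped MatrixGroups ModularForm Classical
open CongruenceSubgroup WeierstrassCurve Literature.NumberTheory.EllipticCurves
  Literature.NumberTheory.EllipticCurves.ModularForms Literature.NumberTheory.EllipticCurves.Rank1Residual
  Literature.NumberTheory.EllipticCurves.SkinnerUrban2014 Literature.NumberTheory.Automorphic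
  Summit.BirchSwinnertonDyer.Rank1Residual

namespace Summit.BirchSwinnertonDyer.BirchSwinnertonDyer.Theorems.KatoNeronIsogenyTransport

/-! ## §1 The arithmetic core and the abstract transport -/

/-- **Arithmetic core.** If `a·ϖ' = q·ϖ` (`q, a ∈ ℤ`, `p ∤ q`) and `s·ϖ'·r` is an algebraic integer for
some natural `s` prime to `p`, then `s'·ϖ·r` is an algebraic integer for some natural `s'` prime to `p`:
`s' = s·|q|²`, since `s q² ϖ r = (q a)·(s ϖ' r)`. [folklore] -/
theorem exists_isIntegral_of_int_mul {p : ℕ} [Fact p.Prime] {ϖ ϖ' : ℚ} {r : ℂ} {q a : ℤ}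
    (hq : ¬ (p : ℤ) ∣ q) (hϖ : (a : ℚ) * ϖ' = q * ϖ)
    (h : ∃ s : ℕ, ¬ p ∣ s ∧ IsIntegral ℤ ((s : ℂ) * ϖ' * r)) :
    ∃ s : ℕ, ¬ p ∣ s ∧ IsIntegral ℤ ((s : ℂ) * ϖ * r) := by
  obtain ⟨s, hps, hint⟩ := h
  have hp : p.Prime := Fact.out
  refine ⟨s * (q.natAbs * q.natAbs), ?_, ?_⟩
  · intro hdvd
    rcases hp.dvd_mul.mp hdvd with h1 | h2
    · exact hps h1
    · rcases hp.dvd_mul.mp h2 with h3 | h3 <;> exact hq (Int.natCast_dvd.mpr h3)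
  · have hϖC : (a : ℂ) * (ϖ' : ℂ) = (q : ℂ) * (ϖ : ℂ) := by exact_mod_cast congrArg (fun x : ℚ ↦ (x : ℂ)) hϖ
    have hsq : ((q.natAbs * q.natAbs : ℕ) : ℂ) = (q : ℂ) * q := by
      have h := congrArg (fun z : ℤ ↦ (z : ℂ)) (@Int.natAbs_mul_self q)
      simpa only [Int.cast_natCast, Int.cast_mul] using h
    have e : ((s * (q.natAbs * q.natAbs) : ℕ) : ℂ) * (ϖ : ℂ) * r =
        ((q : ℂ) * (a : ℂ)) * ((s : ℂ) * (ϖ' : ℂ) * r) := by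
      rw [Nat.cast_mul, hsq]
      linear_combination (-((s : ℂ) * (q : ℂ) * r)) * hϖC
    rw [e]
    exact ((isIntegral_algebraMap (R := ℤ) (A := ℂ) (x := q)).mul
      (isIntegral_algebraMap (R := ℤ) (A := ℂ) (x := a))).mul hint

/-- **Abstract transport of an integrality clause along a `p`-unit period ratio.** If `q·Ω_W = a·Ω_V`
with `p ∤ q`, `a ≠ 0`, and for every `ϖ' ∈ ℚ` with `ϖ'·Ω_W = P` and every `r` with `R r` there is a natural
`s` prime to `p` with `s·ϖ'·r ∈ ℤ̄`, then the same holds with `Ω_V` in place of `Ω_W`: for `ϖ·Ω_V = P` put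
`ϖ' := ϖ·q/a`, so `ϖ'·Ω_W = ϖ·Ω_V = P` and `a·ϖ' = q·ϖ`. (Greenberg–Vatsal's remark that Néron periods in
an isogeny class differ by `p`-units, in the form the F″ transport uses.)
[cite: GreenbergVatsal2000, §3 Remark 3.4] -/
theorem transport_of_int_mul_period {p : ℕ} [Fact p.Prime] {ΩV ΩW P : ℝ} {q a : ℤ}
    (hper : (q : ℝ) * ΩW = a * ΩV) (hq : ¬ (p : ℤ) ∣ q) (ha : a ≠ 0) (R : ℂ → Prop)
    (hW : ∀ (ϖ : ℚ) (r : ℂ), (ϖ : ℝ) * ΩW = P → R r →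
      ∃ s : ℕ, ¬ p ∣ s ∧ IsIntegral ℤ ((s : ℂ) * ϖ * r))
    (ϖ : ℚ) (r : ℂ) (hϖ : (ϖ : ℝ) * ΩV = P) (hr : R r) :
    ∃ s : ℕ, ¬ p ∣ s ∧ IsIntegral ℤ ((s : ℂ) * ϖ * r) := by
  have haQ : (a : ℚ) ≠ 0 := Int.cast_ne_zero.mpr ha
  have haR : (a : ℝ) ≠ 0 := Int.cast_ne_zero.mpr ha
  have hrel : (a : ℚ) * (ϖ * q / a) = q * ϖ := by
    field_simp
  have hϖ'P : ((ϖ * q / a : ℚ) : ℝ) * ΩW = P := by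
    push_cast
    calc (ϖ : ℝ) * q / a * ΩW = (ϖ : ℝ) * ((q : ℝ) * ΩW) / a := by ring
      _ = (ϖ : ℝ) * ((a : ℝ) * ΩV) / a := by rw [hper]
      _ = (ϖ : ℝ) * ΩV := by field_simp
      _ = P := hϖ
  exact exists_isIntegral_of_int_mul hq hrel (hW _ r hϖ'P hr)

/-! ## §2 Néron periods in an isogeny class differ by `p`-units (prime-to-`p` degree) -/

section Periods

variable {p : ℕ} {V W : WeierstrassCurve ℚ} [V.IsElliptic] [W.IsElliptic]
  [V.IsGloballyMinimal] [W.IsGloballyMinimal] {N : ℕ} [NeZero N] {f : CuspForm (Gamma0 N) 2}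

/-- **Real Néron periods under a `ℚ`-isogeny of degree prime to `p`**: for globally minimal `W`, `V` with
newform `f` (the newform only supplies the Néron lattices through `nonempty_modularParametrizationData_of_isNewformOf`)
and `ψ : W → V` with `p ∤ deg ψ`, there are integers `q, a`, BOTH prime to `p` (`a ≠ 0`), with
`q·Ω(W) = a·Ω(V)` — the tree's `exists_int_mul_realPeriodRat_eq_of_isogeny` (`q ∣ deg ψ`, `ab = deg ψ`).
[cite: GreenbergVatsal2000, §3 Remark 3.4] [cite: SilvermanAEC2009, Thm. VI.4.1(b)] -/
theorem exists_int_mul_realPeriodRat_eq_of_not_dvd_degree (hV : IsNewformOf V f) (ψ : Isogeny W V)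
    (hdeg : ¬ p ∣ ψ.degree) :
    ∃ q a : ℤ, ¬ (p : ℤ) ∣ q ∧ a ≠ 0 ∧ ¬ (p : ℤ) ∣ a ∧
      (q : ℝ) * W.realPeriodRat = a * V.realPeriodRat := by
  have hW : IsNewformOf W f := hV.of_isIsogenous ⟨ψ⟩
  obtain ⟨DW⟩ := nonempty_modularParametrizationData_of_isNewformOf hW
  obtain ⟨DV⟩ := nonempty_modularParametrizationData_of_isNewformOf hV
  obtain ⟨q, a, b, -, hqd, hab, h⟩ :=
    exists_int_mul_realPeriodRat_eq_of_isogeny DW DV ψ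
  have hpos := ψ.degree_pos
  refine ⟨q, a, fun hpq ↦ hdeg (Int.natCast_dvd_natCast.mp (hpq.trans hqd)), ?_,
    fun hpa ↦ hdeg (Int.natCast_dvd_natCast.mp (hab ▸ hpa.mul_right b)), h⟩
  rintro rfl
  rw [zero_mul] at hab
  have h0 : ψ.degree = 0 := by exact_mod_cast hab.symm
  omega

/-- **Imaginary Néron periods under a `ℚ`-isogeny of degree prime to `p`**: same as
`exists_int_mul_realPeriodRat_eq_of_not_dvd_degree` for `|Ω⁻|` (`WeierstrassCurve.imaginaryPeriodRat`), from
the tree's `SkinnerUrban2014.exists_int_mul_imaginaryPeriodRat_eq_of_isogeny`.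
[cite: GreenbergVatsal2000, §3 Remark 3.4] [cite: SilvermanAEC2009, Thm. VI.4.1(b)] -/
theorem exists_int_mul_imaginaryPeriodRat_eq_of_not_dvd_degree (hV : IsNewformOf V f) (ψ : Isogeny W V)
    (hdeg : ¬ p ∣ ψ.degree) :
    ∃ q a : ℤ, ¬ (p : ℤ) ∣ q ∧ a ≠ 0 ∧ ¬ (p : ℤ) ∣ a ∧
      (q : ℝ) * W.imaginaryPeriodRat = a * V.imaginaryPeriodRat := by
  have hW : IsNewformOf W f := hV.of_isIsogenous ⟨ψ⟩
  obtain ⟨DW⟩ := nonempty_modularParametrizationData_of_isNewformOf hW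
  obtain ⟨DV⟩ := nonempty_modularParametrizationData_of_isNewformOf hV
  obtain ⟨q, a, b, -, hqd, hab, h⟩ :=
    exists_int_mul_imaginaryPeriodRat_eq_of_isogeny DW DV ψ
  have hpos := ψ.degree_pos
  refine ⟨q, a, fun hpq ↦ hdeg (Int.natCast_dvd_natCast.mp (hpq.trans hqd)), ?_,
    fun hpa ↦ hdeg (Int.natCast_dvd_natCast.mp (hab ▸ hpa.mul_right b)), h⟩
  rintro rfl
  rw [zero_mul] at hab
  have h0 : ψ.degree = 0 := by exact_mod_cast hab.symm
  omega

end Periods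

/-! ## §3 Transport of F″'s hypotheses and of F″'s conclusion along the isogeny class -/

section Transport

variable {p : ℕ} [Fact p.Prime] {V W : WeierstrassCurve ℚ} [V.IsElliptic] [W.IsElliptic]

/-- **F″'s hypotheses move along a `ℚ`-isogeny class.** For `V ∼ W`: the newform (`a_ℓ` is a class
invariant, `IsNewformOf.of_isIsogenous`), "not good and not multiplicative at `p`"
(`X2.addv_iff_of_isIsogenous`), irreducibility of `E[p]` (`X12.irr_iff_of_isIsogenous`) and — under that
irreducibility — the Kosters–Pannekoek clause `7 < p ∨ (gcd(ord_m p, p − 1) = 1 ∧ E(ℚ_p)[p] = 0)` (a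
`ℚ_p`-rational point of order `p` on `W` would push to one on `V` along a prime-to-`p` isogeny,
`TorsTwist.exists_prime_smul_eq_zero_of_isIsogenous`) pass from `V` to `W`.
[cite: SilvermanAEC2009, Cor. III.4.11 and Cor. VII.7.2] -/
theorem hyps_of_isIsogenous (hiso : IsIsogenous V W) {N : ℕ} [NeZero N] {f : CuspForm (Gamma0 N) 2}
    (hV : IsNewformOf V f) (hgood : ¬ V.HasGoodReductionAtPrime p)
    (hmult : ¬ V.HasMultiplicativeReductionAtPrime p) (hirr : V.HasIrreducibleModPGaloisRep p) {m : ℕ}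
    (htors : 7 < p ∨ (Nat.Coprime (orderOf (p : ZMod m)) (p - 1) ∧
      ∀ P : (V.baseChange ℚ_[p]).toAffine.Point, p • P = 0 → P = 0)) :
    IsNewformOf W f ∧ ¬ W.HasGoodReductionAtPrime p ∧ ¬ W.HasMultiplicativeReductionAtPrime p ∧
      W.HasIrreducibleModPGaloisRep p ∧
      (7 < p ∨ (Nat.Coprime (orderOf (p : ZMod m)) (p - 1) ∧
        ∀ P : (W.baseChange ℚ_[p]).toAffine.Point, p • P = 0 → P = 0)) := by
  have hadd : Addv W p := (X2.addv_iff_of_isIsogenous (p := p) hiso).mp ⟨hgood, hmult⟩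
  have hirrW : Irr W p := (X12.irr_iff_of_isIsogenous hiso p).mp hirr
  refine ⟨hV.of_isIsogenous hiso.symm_of_charZero, hadd.1, hadd.2, hirrW, ?_⟩
  rcases htors with h7 | ⟨hcop, hT⟩
  · exact Or.inl h7
  · refine Or.inr ⟨hcop, fun P hP ↦ ?_⟩
    by_contra hP0
    have hPz : (p : ℤ) • P = 0 := by rw [natCast_zsmul]; exact hP
    obtain ⟨P₀, hP₀, hP₀p⟩ := TorsTwist.exists_prime_smul_eq_zero_of_isIsogenous hirr hiso hP0 hPz
    exact hP₀ (hT P₀ (by rw [← natCast_zsmul]; exact hP₀p))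

/-- **F″'s conclusion moves along a `ℚ`-isogeny class (both parities, verbatim).** Let `V ∼ W` be globally
minimal elliptic curves over `ℚ` with `V[p]` irreducible and newform `f`, `χ` a Dirichlet character mod `m`.
If at `W`, for all `ϖ ∈ ℚ`, `r ∈ ℂ`: [`χ` even, `ϖ·Ω(W) = Ω⁺_f`,
`∏_{ℓ ∥ N}(ℓ − a_ℓχ(ℓ))(ℓ − a_ℓχ(ℓ)⁻¹)·Σ_aχ(a){∞,a/m}_f = r·Ω⁺_f` ⟹ `∃ s, p ∤ s, s·ϖ·r ∈ ℤ̄`] and [`χ` odd,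
`ϖ·|Ω⁻(W)| = Ω⁻_f`, same product `= r·Ω⁻_f·i` ⟹ same], then the same two clauses hold at `V`. Proof: the
class is joined by an isogeny `ψ : W → V` of degree prime to `p` (`exists_isogeny_not_dvd_degree_of_irreducible`),
so `q·Ω^±(W) = a·Ω^±(V)` with `p ∤ q`, `a ≠ 0` (§2) and `transport_of_int_mul_period` applies; `a_ℓ(W) = a_ℓ(V)`
(`IsIsogenous.LFunction_eq`). This is item 1 ("lattice / transport `E• → V`") of the derivation displayed
in the docstring of `kato_neron_isIntegral_twistedSymbolSum_of_additive_five_le`, as a theorem.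
[cite: GreenbergVatsal2000, §3 Remark 3.4] [cite: Kato2004Asterisque, §8.3 (p. 181)] [cite: Wuthrich2014, §3 Prop. 8] -/
theorem body_of_isIsogenous [V.IsGloballyMinimal] [W.IsGloballyMinimal] (hiso : IsIsogenous V W)
    (hirr : V.HasIrreducibleModPGaloisRep p) {N : ℕ} [NeZero N] {f : CuspForm (Gamma0 N) 2}
    (hV : IsNewformOf V f) {m : ℕ} [NeZero m] (χ : DirichletCharacter ℂ m)
    (hW : ∀ (ϖ : ℚ) (r : ℂ),
      (χ.Even → (ϖ : ℝ) * W.realPeriodRat = plusPeriod f →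
        (∏ ℓ ∈ N.primeFactors with ¬ ℓ ^ 2 ∣ N,
            (((ℓ : ℂ) - (W.LFunction ℓ : ℂ) * χ (ℓ : ZMod m)) *
              ((ℓ : ℂ) - (W.LFunction ℓ : ℂ) * (χ (ℓ : ZMod m))⁻¹))) *
            twistedSymbolSum f χ = r * (plusPeriod f : ℂ) →
        ∃ s : ℕ, ¬ p ∣ s ∧ IsIntegral ℤ ((s : ℂ) * ϖ * r)) ∧
      (χ.Odd → (ϖ : ℝ) * W.imaginaryPeriodRat = minusPeriod f →
        (∏ ℓ ∈ N.primeFactors with ¬ ℓ ^ 2 ∣ N,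
            (((ℓ : ℂ) - (W.LFunction ℓ : ℂ) * χ (ℓ : ZMod m)) *
              ((ℓ : ℂ) - (W.LFunction ℓ : ℂ) * (χ (ℓ : ZMod m))⁻¹))) *
            twistedSymbolSum f χ = r * (minusPeriod f : ℂ) * Complex.I →
        ∃ s : ℕ, ¬ p ∣ s ∧ IsIntegral ℤ ((s : ℂ) * ϖ * r)))
    (ϖ : ℚ) (r : ℂ) :
    (χ.Even → (ϖ : ℝ) * V.realPeriodRat = plusPeriod f →
        (∏ ℓ ∈ N.primeFactors with ¬ ℓ ^ 2 ∣ N,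
            (((ℓ : ℂ) - (V.LFunction ℓ : ℂ) * χ (ℓ : ZMod m)) *
              ((ℓ : ℂ) - (V.LFunction ℓ : ℂ) * (χ (ℓ : ZMod m))⁻¹))) *
            twistedSymbolSum f χ = r * (plusPeriod f : ℂ) →
        ∃ s : ℕ, ¬ p ∣ s ∧ IsIntegral ℤ ((s : ℂ) * ϖ * r)) ∧
      (χ.Odd → (ϖ : ℝ) * V.imaginaryPeriodRat = minusPeriod f →
        (∏ ℓ ∈ N.primeFactors with ¬ ℓ ^ 2 ∣ N,
            (((ℓ : ℂ) - (V.LFunction ℓ : ℂ) * χ (ℓ : ZMod m)) *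
              ((ℓ : ℂ) - (V.LFunction ℓ : ℂ) * (χ (ℓ : ZMod m))⁻¹))) *
            twistedSymbolSum f χ = r * (minusPeriod f : ℂ) * Complex.I →
        ∃ s : ℕ, ¬ p ∣ s ∧ IsIntegral ℤ ((s : ℂ) * ϖ * r)) := by
  have hp0 : (p : ℚ) ≠ 0 := by exact_mod_cast (Fact.out : p.Prime).ne_zero
  have hisoWV : IsIsogenous W V := hiso.symm_of_charZero
  have hirrW : W.HasIrreducibleModPGaloisRep p := (X12.irr_iff_of_isIsogenous hiso p).mp hirr
  obtain ⟨ψ, hdeg⟩ := exists_isogeny_not_dvd_degree_of_irreducible hp0 hirrW hisoWV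
  have hL : W.LFunction = V.LFunction := hisoWV.LFunction_eq
  simp only [hL] at hW
  obtain ⟨q, a, hq, ha, -, hper⟩ := exists_int_mul_realPeriodRat_eq_of_not_dvd_degree (p := p) hV ψ hdeg
  obtain ⟨q', a', hq', ha', -, hper'⟩ :=
    exists_int_mul_imaginaryPeriodRat_eq_of_not_dvd_degree (p := p) hV ψ hdeg
  refine ⟨fun heven hϖ hr ↦ ?_, fun hodd hϖ hr ↦ ?_⟩
  · exact transport_of_int_mul_period hper hq ha
      (fun r ↦ (∏ ℓ ∈ N.primeFactors with ¬ ℓ ^ 2 ∣ N,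
            (((ℓ : ℂ) - (V.LFunction ℓ : ℂ) * χ (ℓ : ZMod m)) *
              ((ℓ : ℂ) - (V.LFunction ℓ : ℂ) * (χ (ℓ : ZMod m))⁻¹))) *
            twistedSymbolSum f χ = r * (plusPeriod f : ℂ))
      (fun ϖ₁ r₁ h₁ h₂ ↦ (hW ϖ₁ r₁).1 heven h₁ h₂) ϖ r hϖ hr
  · exact transport_of_int_mul_period hper' hq' ha'
      (fun r ↦ (∏ ℓ ∈ N.primeFactors with ¬ ℓ ^ 2 ∣ N,
            (((ℓ : ℂ) - (V.LFunction ℓ : ℂ) * χ (ℓ : ZMod m)) *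
              ((ℓ : ℂ) - (V.LFunction ℓ : ℂ) * (χ (ℓ : ZMod m))⁻¹))) *
            twistedSymbolSum f χ = r * (minusPeriod f : ℂ) * Complex.I)
      (fun ϖ₁ r₁ h₁ h₂ ↦ (hW ϖ₁ r₁).2 hodd h₁ h₂) ϖ r hϖ hr

end Transport

/-! ## §4 The socket for P1–P4: F″ from F″'s conclusion at ONE globally minimal member per class -/

/-- **F″ from its conclusion at one globally minimal member of each isogeny class** (the socket into which
P1–P4 of the programme plug: they prove F″'s conclusion at Kato's member `E•`, the globally minimal curve of the
class whose Tate module is Kato's lattice `V_{ℤ_p}(f)(1)`). If for every globally minimal `V` satisfying the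
hypotheses of `kato_neron_isIntegral_twistedSymbolSum_of_additive_five_le` at `(f, p, m, χ)` there is SOME
globally minimal `W ∼ V` at which the two conclusion clauses hold (for all `ϖ, r`), then F″ holds — by
`body_of_isIsogenous` (the hypotheses include `V[p]` irreducible).
[cite: Kato2004Asterisque, §8.3 (p. 181) and (8.1.3) (p. 180)] [cite: GreenbergVatsal2000, §3 Remark 3.4] -/
theorem kato_neron_five_le_of_forall_exists_member
    (H : ∀ (V : WeierstrassCurve ℚ) [V.IsElliptic] [V.IsGloballyMinimal] {N : ℕ} [NeZero N]
      (f : CuspForm (Gamma0 N) 2), IsNewformOf V f → ∀ (p : ℕ) [Fact p.Prime], 5 ≤ p →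
      ¬ V.HasGoodReductionAtPrime p → ¬ V.HasMultiplicativeReductionAtPrime p →
      V.HasIrreducibleModPGaloisRep p → ∀ (m : ℕ) [NeZero m], m.Coprime (p * N) →
      (7 < p ∨ (Nat.Coprime (orderOf (p : ZMod m)) (p - 1) ∧
        ∀ P : (V.baseChange ℚ_[p]).toAffine.Point, p • P = 0 → P = 0)) →
      ∀ (χ : DirichletCharacter ℂ m), χ.IsPrimitive → χ ≠ 1 → ¬ p ∣ orderOf χ →
      ∃ (W : WeierstrassCurve ℚ) (_ : W.IsElliptic) (_ : W.IsGloballyMinimal), IsIsogenous V W ∧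
        ∀ (ϖ : ℚ) (r : ℂ),
          (χ.Even → (ϖ : ℝ) * W.realPeriodRat = plusPeriod f →
            (∏ ℓ ∈ N.primeFactors with ¬ ℓ ^ 2 ∣ N,
                (((ℓ : ℂ) - (W.LFunction ℓ : ℂ) * χ (ℓ : ZMod m)) *
                  ((ℓ : ℂ) - (W.LFunction ℓ : ℂ) * (χ (ℓ : ZMod m))⁻¹))) *
                twistedSymbolSum f χ = r * (plusPeriod f : ℂ) →
            ∃ s : ℕ, ¬ p ∣ s ∧ IsIntegral ℤ ((s : ℂ) * ϖ * r)) ∧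
          (χ.Odd → (ϖ : ℝ) * W.imaginaryPeriodRat = minusPeriod f →
            (∏ ℓ ∈ N.primeFactors with ¬ ℓ ^ 2 ∣ N,
                (((ℓ : ℂ) - (W.LFunction ℓ : ℂ) * χ (ℓ : ZMod m)) *
                  ((ℓ : ℂ) - (W.LFunction ℓ : ℂ) * (χ (ℓ : ZMod m))⁻¹))) *
                twistedSymbolSum f χ = r * (minusPeriod f : ℂ) * Complex.I →
            ∃ s : ℕ, ¬ p ∣ s ∧ IsIntegral ℤ ((s : ℂ) * ϖ * r))) :
    kato_neron_isIntegral_twistedSymbolSum_of_additive_five_le := by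
  intro V _ _ N _ f hf p _ hp5 hgood hmult hirr m _ hm htors χ hχ hχ1 hord ϖ r
  obtain ⟨W, hWE, hWM, hiso, hbody⟩ := H V f hf p hp5 hgood hmult hirr m hm htors χ hχ hχ1 hord
  exact body_of_isIsogenous hiso hirr hf χ hbody ϖ r

/-- **Same socket, with the member's conclusion granted only under the member's own hypotheses** (the form a
proof "F″ at Kato's member" naturally has): for every `V` as in F″ there is a globally minimal `W ∼ V` such
that [`IsNewformOf W f`, `W` neither good nor multiplicative at `p`, `W[p]` irreducible, and the
Kosters–Pannekoek clause for `W`] imply F″'s two conclusion clauses at `W`. Then F″ — the member's hypotheses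
are supplied by `hyps_of_isIsogenous`. [cite: Kato2004Asterisque, §8.3 (p. 181) and (8.1.3) (p. 180)]
[cite: GreenbergVatsal2000, §3 Remark 3.4] -/
theorem kato_neron_five_le_of_forall_exists_member'
    (H : ∀ (V : WeierstrassCurve ℚ) [V.IsElliptic] [V.IsGloballyMinimal] {N : ℕ} [NeZero N]
      (f : CuspForm (Gamma0 N) 2), IsNewformOf V f → ∀ (p : ℕ) [Fact p.Prime], 5 ≤ p →
      ¬ V.HasGoodReductionAtPrime p → ¬ V.HasMultiplicativeReductionAtPrime p →
      V.HasIrreducibleModPGaloisRep p → ∀ (m : ℕ) [NeZero m], m.Coprime (p * N) →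
      (7 < p ∨ (Nat.Coprime (orderOf (p : ZMod m)) (p - 1) ∧
        ∀ P : (V.baseChange ℚ_[p]).toAffine.Point, p • P = 0 → P = 0)) →
      ∀ (χ : DirichletCharacter ℂ m), χ.IsPrimitive → χ ≠ 1 → ¬ p ∣ orderOf χ →
      ∃ (W : WeierstrassCurve ℚ) (_ : W.IsElliptic) (_ : W.IsGloballyMinimal), IsIsogenous V W ∧
        (IsNewformOf W f → ¬ W.HasGoodReductionAtPrime p → ¬ W.HasMultiplicativeReductionAtPrime p →
          W.HasIrreducibleModPGaloisRep p →
          (7 < p ∨ (Nat.Coprime (orderOf (p : ZMod m)) (p - 1) ∧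
            ∀ P : (W.baseChange ℚ_[p]).toAffine.Point, p • P = 0 → P = 0)) →
        ∀ (ϖ : ℚ) (r : ℂ),
          (χ.Even → (ϖ : ℝ) * W.realPeriodRat = plusPeriod f →
            (∏ ℓ ∈ N.primeFactors with ¬ ℓ ^ 2 ∣ N,
                (((ℓ : ℂ) - (W.LFunction ℓ : ℂ) * χ (ℓ : ZMod m)) *
                  ((ℓ : ℂ) - (W.LFunction ℓ : ℂ) * (χ (ℓ : ZMod m))⁻¹))) *
                twistedSymbolSum f χ = r * (plusPeriod f : ℂ) →
            ∃ s : ℕ, ¬ p ∣ s ∧ IsIntegral ℤ ((s : ℂ) * ϖ * r)) ∧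
          (χ.Odd → (ϖ : ℝ) * W.imaginaryPeriodRat = minusPeriod f →
            (∏ ℓ ∈ N.primeFactors with ¬ ℓ ^ 2 ∣ N,
                (((ℓ : ℂ) - (W.LFunction ℓ : ℂ) * χ (ℓ : ZMod m)) *
                  ((ℓ : ℂ) - (W.LFunction ℓ : ℂ) * (χ (ℓ : ZMod m))⁻¹))) *
                twistedSymbolSum f χ = r * (minusPeriod f : ℂ) * Complex.I →
            ∃ s : ℕ, ¬ p ∣ s ∧ IsIntegral ℤ ((s : ℂ) * ϖ * r)))) :
    kato_neron_isIntegral_twistedSymbolSum_of_additive_five_le := by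
  refine kato_neron_five_le_of_forall_exists_member
    fun V _ _ N _ f hf p _ hp5 hgood hmult hirr m _ hm htors χ hχ hχ1 hord ↦ ?_
  obtain ⟨W, hWE, hWM, hiso, hbody⟩ := H V f hf p hp5 hgood hmult hirr m hm htors χ hχ hχ1 hord
  obtain ⟨hfW, hgoodW, hmultW, hirrW, htorsW⟩ := hyps_of_isIsogenous hiso hf hgood hmult hirr htors
  exact ⟨W, hWE, hWM, hiso, hbody hfW hgoodW hmultW hirrW htorsW⟩

end Summit.BirchSwinnertonDyer.BirchSwinnertonDyer.Theorems.KatoNeronIsogenyTransport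

end
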